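import Summits.Parity.GeneralizedHardyLittlewood.Theses.ParityLeakOneFifth

/-!
# Line `birth` — BC3 skeleton for the crux `CalibratedE1` (stmt-Parity-18379)

Route `ParityLeakOneFifth` (route-Parity-ParityLeakOneFifth), sub-problem `GeneralizedHardyLittlewood`, crux K2
(rank 3, by name `Summit.Parity.GeneralizedHardyLittlewood.Theses.ParityLeakOneFifth.CalibratedE1`):
with `t₁ = Π_Φ / B` the exact calibration, the Type-II functional

  `F(Φ) := W_Φ − t₁ · W_λ`,  `W_Φ = Σ_{x<n≤2x} Φ(n+2)(a_n − b_n)`, `W_λ = Σ λ(n+2)(a_n − b_n)`,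
  `Π_Φ = Σ b_n λ(n+2) Φ(n+2)`, `B = Σ b_n`,

(`a = Λ'`, `b` = the `z`-rough model `1[P⁻(n) ≥ z]/V(z)`, `z = exp((log log x)²)`, `Φ` = the (W1)@1/5 type function
on `m = n+2` with least prime factor in the window `[x^{ε²}, x^{1/5})`) is `≤ θ·x/log x` for every `θ > 0`.

## The line: BAND SPLIT of the type window at `1/14` (route header, TWO-LAYER PLAN `CalibratedE1 ⇐ Low → High`)

`F` is LINEAR in the type function `Φ` (the calibration coefficient `Π_Φ/B` is linear in `Φ`; `B`, `W_λ` do not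
depend on `Φ`), and the window indicator is additive: for `x ≥ 1` and `ε² ≤ 1/14`,
`1[x^{ε²} ≤ q < x^{1/5}] = 1[x^{ε²} ≤ q < x^{1/14}] + 1[x^{1/14} ≤ q < x^{1/5}]` (`q = P⁻(n+2)`). Hence
`F(Φ) = F(Φ_low) + F(Φ_high)` EXACTLY (`calF_split`), and each band member is itself parity-line blind
(on Bombieri's line `a = b(1 + tλ)` every `F(Ψ)` vanishes, whatever `Ψ`). The two registered stubs:

* `stub_lowBand` — the calibrated functional of the LOW band `P⁻(n+2) ∈ [x^{ε²}, x^{1/14})` is `≤ θ·x/log x`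
  (every `θ > 0`, `ε ≤ ε₁`, `x ≥ x₀`). Here `n + 2 = p·ℓ` carries a located small prime `p < x^{1/14}`, a flexible
  factor of the modulus `p·d` (`d ≤ x^{1/2−2ε}` from the (W1) weight): total level `x^{1/2 + 1/14 − 2ε} = x^{4/7 − 2ε}`,
  the Bombieri–Friedlander–Iwaniec range (BFI1986 Thm 10, level 4/7) after a β-sieve majorant/minorant for the
  condition "no prime factor of `n+2` below `x^{ε²}`" (fundamental lemma, tree). Size M–L. Why it might fail: the
  weight `μ(d)·1[P⁻(d) ≥ x^{1/5}]` is not well-factorable near `d ≈ x^{1/2}`, so BFI's mean-value theorem must be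
  replaced by the Fouvry/BFI results for moduli `p·d` with only the small factor `p` flexible.
* `stub_highBand` — the same for the HIGH band `P⁻(n+2) ∈ [x^{1/14}, x^{1/5})`: the research core of K2 (no
  Type-II-species theorem for shifted primes is known, Harman 2007 §14.2); on this band `n+2` has `≤ 14` prime
  factors, all `≥ x^{1/14}`, and the (W1) weight sees only those `≥ x^{1/5}`. Size XL / open.

`calibratedE1_of_bands : ‹stub_lowBand sig› → ‹stub_highBand sig› → ‹the crux's own statement›` is the REAL
composition (window additivity `calF_split` + `ε₁ := min εL εH ¼`, `θ/2 + θ/2`, `x₀ := max xL xH 1`; no sorry),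
and `CalibratedE1_of : CalibratedE1 := calibratedE1_of_bands stub_lowBand stub_highBand` concludes the crux BY NAME
(the audit `#h21_check_skeleton` admits only registered obligations as hypotheses of the by-name theorem, so the
raw-signature hypothesis form is `calibratedE1_of_bands` and the by-name form is hypothesis-free; `crux_iff`,
`lowBand_iff`, `highBand_iff` are `Iff.rfl`, certifying that the `calF` spelling below IS the `let` spelling of the
crux and of the two stubs).

The split is SUFFICIENT, not claimed equivalent: `stub_lowBand ∧ stub_highBand → CalibratedE1`; the converse fails
only if the two bands' calibrated functionals were large with opposite signs — each band statement is the same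
"primes vs. `z`-rough model against a divisor-supported weight of level `x^{1/2−2ε}`, minus its own calibration"
and is expected for the true twin host exactly as K2 is. Neither stub is the crux or the summit in costume: BC3 probes
`stub → CalibratedE1` and `stub → GeneralizedHardyLittlewood` by `first | exact? | simpa [CalibratedE1] | (unfold; simpa) | aesop`
FAIL (registrar's folder `bc/probes_*.lean`, verdicts in NOTES / evidence note).

Stub signatures are SELF-CONTAINED (verbatim the crux's `let` spelling with only the window changed), so a prover's
`--supports stmt-Parity-18379` theorem can restate them without importing this file.

`sorry` occurs ONLY in `stub_lowBand` and `stub_highBand` (sorries = 2 = stubs); everything else is kernel-checked.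
-/

namespace Summit.Parity.GeneralizedHardyLittlewood.Cruxes.CalibratedE1.Birth

open scoped BigOperators Topology Manifold Classical MeasureTheory ProbabilityTheory Matrix InnerProductSpace ComplexConjugate ContinuousMap
open Filter Set Function TopologicalSpace MeasureTheory
open Summit.Parity.GeneralizedHardyLittlewood.Theses.ParityLeakOneFifth (CalibratedE1)

/-! ## The two registered OPEN stubs (self-contained signatures) -/

/-- **Stub LOW — the calibrated Type-II functional on the low band `P⁻(n+2) ∈ [x^{ε²}, x^{1/14})`.**
Verbatim the crux `CalibratedE1` with the type window `[x^{ε²}, x^{1/5})` replaced by `[x^{ε²}, x^{1/14})`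
(in `Φ` only; the (W1) divisor weight, `z`, `V`, `b`, `a` and the calibration are unchanged).
Intended technique: β-sieve (fundamental lemma) for the `x^{ε²}`-roughness of `n+2`, then primes in progressions to
moduli `p·d ≤ x^{4/7−2ε}` with the located small prime `p < x^{1/14}` as the flexible factor (BFI1986 Thm 10;
Fouvry–Iwaniec), and the same dispersion for the `z`-rough model `b`. Why it might fail: `μ(d)1[P⁻(d) ≥ x^{1/5}]`,
`d ≤ x^{1/2−2ε}`, is not well-factorable, so only the factor `p` is flexible. Sources: BFI1986, Harman2007 §14,
arXiv:2407.14368. -/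
theorem stub_lowBand :
    ∃ ε₁ : ℝ, 0 < ε₁ ∧ ∀ ε : ℝ, 0 < ε → ε ≤ ε₁ → ∀ θ : ℝ, 0 < θ → ∃ x₀ : ℕ, ∀ x : ℕ, x₀ ≤ x → let z : ℝ := Real.exp (Real.log (Real.log (x : ℝ)) ^ 2); let V : ℝ := ∏ p ∈ (Finset.range ⌈z⌉₊).filter Nat.Prime, (1 - 1 / (p : ℝ)); let b : ℕ → ℝ := fun n => if ∀ p ∈ n.primeFactors, z ≤ (p : ℝ) then 1 / V else 0; let a : ℕ → ℝ := fun n => if n.Prime then Real.log (n : ℝ) else 0; let Φ : ℕ → ℝ := fun m => if (x : ℝ) ^ (ε ^ 2) ≤ (m.minFac : ℝ) ∧ (m.minFac : ℝ) < (x : ℝ) ^ ((1 : ℝ) / 14) then ∑ d ∈ (Nat.divisors m).filter (fun d : ℕ => (d : ℝ) ≤ (x : ℝ) ^ ((1 : ℝ) / 2 - 2 * ε) ∧ ∀ p ∈ d.primeFactors, (x : ℝ) ^ ((1 : ℝ) / 5) ≤ (p : ℝ)), (ArithmeticFunction.moebius d : ℝ) else 0; (∑ n ∈ Finset.Ioc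 x (2 * x), Φ (n + 2) * (a n - b n)) - (∑ n ∈ Finset.Ioc x (2 * x), b n * (ArithmeticFunction.liouville (n + 2) : ℝ) * Φ (n + 2)) / (∑ n ∈ Finset.Ioc x (2 * x), b n) * (∑ n ∈ Finset.Ioc x (2 * x), (ArithmeticFunction.liouville (n + 2) : ℝ) * (a n - b n)) ≤ θ * (x : ℝ) / Real.log (x : ℝ) := by
  sorry

/-- **Stub HIGH — the calibrated Type-II functional on the high band `P⁻(n+2) ∈ [x^{1/14}, x^{1/5})`.**
Verbatim the crux `CalibratedE1` with the type window replaced by `[x^{1/14}, x^{1/5})`. The research core of K2: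
a Type-II-SPECIES statement for shifted primes (`n+2` with all prime factors `≥ x^{1/14}`, hence `≤ 14` of them),
blind to Bombieri's parity line by the calibration. No such theorem is known (Harman2007 §14.2); the intended inputs
are Harman's comparison principle / alternative sieve on the bilinear forms `Σ_{p ~ P} Σ_ℓ` with `P ∈ [x^{1/14}, x^{1/5})`
and level-`1/2` distribution (BFI1986, DukeFriedlanderIwaniec1997, arXiv:2407.14368 §6). Why it might fail: modulo
E1-asymptotics it contains the lower-sided Pintz inequality on this band (route header, K2's risk). Sources:
Harman2007, arXiv:2407.14368, BFI1986, DukeFriedlanderIwaniec1997. -/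
theorem stub_highBand :
    ∃ ε₁ : ℝ, 0 < ε₁ ∧ ∀ ε : ℝ, 0 < ε → ε ≤ ε₁ → ∀ θ : ℝ, 0 < θ → ∃ x₀ : ℕ, ∀ x : ℕ, x₀ ≤ x → let z : ℝ := Real.exp (Real.log (Real.log (x : ℝ)) ^ 2); let V : ℝ := ∏ p ∈ (Finset.range ⌈z⌉₊).filter Nat.Prime, (1 - 1 / (p : ℝ)); let b : ℕ → ℝ := fun n => if ∀ p ∈ n.primeFactors, z ≤ (p : ℝ) then 1 / V else 0; let a : ℕ → ℝ := fun n => if n.Prime then Real.log (n : ℝ) else 0; let Φ : ℕ → ℝ := fun m => if (x : ℝ) ^ ((1 : ℝ) / 14) ≤ (m.minFac : ℝ) ∧ (m.minFac : ℝ) < (x : ℝ) ^ ((1 : ℝ) / 5) then ∑ d ∈ (Nat.divisors m).filter (fun d : ℕ => (d : ℝ) ≤ (x : ℝ) ^ ((1 : ℝ) / 2 - 2 * ε) ∧ ∀ p ∈ d.primeFactors, (x : ℝ) ^ ((1 : ℝ) / 5) ≤ (p : ℝ)), (ArithmeticFunction.moebius d : ℝ) else 0; (∑ n ∈ Finset.Ioc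 x (2 * x), Φ (n + 2) * (a n - b n)) - (∑ n ∈ Finset.Ioc x (2 * x), b n * (ArithmeticFunction.liouville (n + 2) : ℝ) * Φ (n + 2)) / (∑ n ∈ Finset.Ioc x (2 * x), b n) * (∑ n ∈ Finset.Ioc x (2 * x), (ArithmeticFunction.liouville (n + 2) : ℝ) * (a n - b n)) ≤ θ * (x : ℝ) / Real.log (x : ℝ) := by
  sorry

/-! ## The crux's objects, named (verbatim the `let`s of the route file, the type window as a parameter) -/

/-- `z = exp((log log x)²)` — verbatim the crux's `let z`. -/
noncomputable def z (x : ℕ) : ℝ := Real.exp (Real.log (Real.log (x : ℝ)) ^ 2)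

/-- `V(z) = ∏_{p < z} (1 − 1/p)` — verbatim the crux's `let V`. -/
noncomputable def V (x : ℕ) : ℝ := ∏ p ∈ (Finset.range ⌈z x⌉₊).filter Nat.Prime, (1 - 1 / (p : ℝ))

/-- The `z`-rough model `b_n = 1[P⁻(n) ≥ z]/V(z)` — verbatim the crux's `let b`. -/
noncomputable def b (x : ℕ) : ℕ → ℝ := fun n => if ∀ p ∈ n.primeFactors, z x ≤ (p : ℝ) then 1 / V x else 0

/-- The host `a = Λ'` (log on primes) — verbatim the crux's `let a`. -/
noncomputable def a : ℕ → ℝ := fun n => if n.Prime then Real.log (n : ℝ) else 0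

/-- The (W1)@1/5 divisor weight `D(m) = Σ_{d | m, d ≤ x^{1/2−2ε}, P⁻(d) ≥ x^{1/5}} μ(d)` (the `then` branch of the
crux's `let Φ`). -/
noncomputable def D (ε : ℝ) (x : ℕ) (m : ℕ) : ℝ :=
  ∑ d ∈ (Nat.divisors m).filter (fun d : ℕ => (d : ℝ) ≤ (x : ℝ) ^ ((1 : ℝ) / 2 - 2 * ε) ∧
    ∀ p ∈ d.primeFactors, (x : ℝ) ^ ((1 : ℝ) / 5) ≤ (p : ℝ)), (ArithmeticFunction.moebius d : ℝ)

/-- The type function with window `[lo, hi)` on the least prime factor: `Φw lo hi m = 1[lo ≤ P⁻(m) < hi]·D(m)`;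
the crux's `let Φ` is `Φw (x^{ε²}) (x^{1/5})`. -/
noncomputable def Φw (ε : ℝ) (x : ℕ) (lo hi : ℝ) : ℕ → ℝ := fun m =>
  if lo ≤ (m.minFac : ℝ) ∧ (m.minFac : ℝ) < hi then D ε x m else 0

/-- The calibrated functional `F(Φ) = W_Φ − (Π_Φ/B)·W_λ` for the window `[lo, hi)` — verbatim the crux's body. -/
noncomputable def calF (ε : ℝ) (x : ℕ) (lo hi : ℝ) : ℝ :=
  (∑ n ∈ Finset.Ioc x (2 * x), Φw ε x lo hi (n + 2) * (a n - b x n)) -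
    (∑ n ∈ Finset.Ioc x (2 * x), b x n * (ArithmeticFunction.liouville (n + 2) : ℝ) * Φw ε x lo hi (n + 2)) /
      (∑ n ∈ Finset.Ioc x (2 * x), b x n) *
      (∑ n ∈ Finset.Ioc x (2 * x), (ArithmeticFunction.liouville (n + 2) : ℝ) * (a n - b x n))

/-- The crux, respelled with `calF` (full window `[x^{ε²}, x^{1/5})`): DEFINITIONALLY the route decl (`Iff.rfl`).
[folklore] -/
theorem crux_iff :
    CalibratedE1 ↔
      ∃ ε₁ : ℝ, 0 < ε₁ ∧ ∀ ε : ℝ, 0 < ε → ε ≤ ε₁ → ∀ θ : ℝ, 0 < θ → ∃ x₀ : ℕ, ∀ x : ℕ, x₀ ≤ x →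
        calF ε x ((x : ℝ) ^ (ε ^ 2)) ((x : ℝ) ^ ((1 : ℝ) / 5)) ≤ θ * (x : ℝ) / Real.log (x : ℝ) :=
  Iff.rfl

/-- The low stub's signature, respelled with `calF` (window `[x^{ε²}, x^{1/14})`): definitional (`Iff.rfl`). [folklore] -/
theorem lowBand_iff :
    (∃ ε₁ : ℝ, 0 < ε₁ ∧ ∀ ε : ℝ, 0 < ε → ε ≤ ε₁ → ∀ θ : ℝ, 0 < θ → ∃ x₀ : ℕ, ∀ x : ℕ, x₀ ≤ x → let z : ℝ := Real.exp (Real.log (Real.log (x : ℝ)) ^ 2); let V : ℝ := ∏ p ∈ (Finset.range ⌈z⌉₊).filter Nat.Prime, (1 - 1 / (p : ℝ)); let b : ℕ → ℝ := fun n => if ∀ p ∈ n.primeFactors, z ≤ (p : ℝ) then 1 / V else 0; let a : ℕ → ℝ := fun n => if n.Prime then Real.log (n : ℝ) else 0; let Φ : ℕ → ℝ := fun m => if (x : ℝ) ^ (ε ^ 2) ≤ (m.minFac : ℝ) ∧ (m.minFac : ℝ) < (x : ℝ) ^ ((1 : ℝ) / 14) then ∑ d ∈ (Nat.divisors m).filter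 (fun d : ℕ => (d : ℝ) ≤ (x : ℝ) ^ ((1 : ℝ) / 2 - 2 * ε) ∧ ∀ p ∈ d.primeFactors, (x : ℝ) ^ ((1 : ℝ) / 5) ≤ (p : ℝ)), (ArithmeticFunction.moebius d : ℝ) else 0; (∑ n ∈ Finset.Ioc x (2 * x), Φ (n + 2) * (a n - b n)) - (∑ n ∈ Finset.Ioc x (2 * x), b n * (ArithmeticFunction.liouville (n + 2) : ℝ) * Φ (n + 2)) / (∑ n ∈ Finset.Ioc x (2 * x), b n) * (∑ n ∈ Finset.Ioc x (2 * x), (ArithmeticFunction.liouville (n + 2) : ℝ) * (a n - b n)) ≤ θ * (x : ℝ) / Real.log (x : ℝ))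
    ↔ ∃ ε₁ : ℝ, 0 < ε₁ ∧ ∀ ε : ℝ, 0 < ε → ε ≤ ε₁ → ∀ θ : ℝ, 0 < θ → ∃ x₀ : ℕ, ∀ x : ℕ, x₀ ≤ x →
        calF ε x ((x : ℝ) ^ (ε ^ 2)) ((x : ℝ) ^ ((1 : ℝ) / 14)) ≤ θ * (x : ℝ) / Real.log (x : ℝ) :=
  Iff.rfl

/-- The high stub's signature, respelled with `calF` (window `[x^{1/14}, x^{1/5})`): definitional (`Iff.rfl`). [folklore] -/
theorem highBand_iff :
    (∃ ε₁ : ℝ, 0 < ε₁ ∧ ∀ ε : ℝ, 0 < ε → ε ≤ ε₁ → ∀ θ : ℝ, 0 < θ → ∃ x₀ : ℕ, ∀ x : ℕ, x₀ ≤ x → let z : ℝ := Real.exp (Real.log (Real.log (x : ℝ)) ^ 2); let V : ℝ := ∏ p ∈ (Finset.range ⌈z⌉₊).filter Nat.Prime, (1 - 1 / (p : ℝ)); let b : ℕ → ℝ := fun n => if ∀ p ∈ n.primeFactors, z ≤ (p : ℝ) then 1 / V else 0; let a : ℕ → ℝ := fun n => if n.Prime then Real.log (n : ℝ) else 0; let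 Φ : ℕ → ℝ := fun m => if (x : ℝ) ^ ((1 : ℝ) / 14) ≤ (m.minFac : ℝ) ∧ (m.minFac : ℝ) < (x : ℝ) ^ ((1 : ℝ) / 5) then ∑ d ∈ (Nat.divisors m).filter (fun d : ℕ => (d : ℝ) ≤ (x : ℝ) ^ ((1 : ℝ) / 2 - 2 * ε) ∧ ∀ p ∈ d.primeFactors, (x : ℝ) ^ ((1 : ℝ) / 5) ≤ (p : ℝ)), (ArithmeticFunction.moebius d : ℝ) else 0; (∑ n ∈ Finset.Ioc x (2 * x), Φ (n + 2) * (a n - b n)) - (∑ n ∈ Finset.Ioc x (2 * x), b n * (ArithmeticFunction.liouville (n + 2) : ℝ) * Φ (n + 2)) / (∑ n ∈ Finset.Ioc x (2 * x), b n) * (∑ n ∈ Finset.Ioc x (2 * x), (ArithmeticFunction.liouville (n + 2) : ℝ) * (a n - b n)) ≤ θ * (x : ℝ) / Real.log (x : ℝ))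
    ↔ ∃ ε₁ : ℝ, 0 < ε₁ ∧ ∀ ε : ℝ, 0 < ε → ε ≤ ε₁ → ∀ θ : ℝ, 0 < θ → ∃ x₀ : ℕ, ∀ x : ℕ, x₀ ≤ x →
        calF ε x ((x : ℝ) ^ ((1 : ℝ) / 14)) ((x : ℝ) ^ ((1 : ℝ) / 5)) ≤ θ * (x : ℝ) / Real.log (x : ℝ) :=
  Iff.rfl

/-! ## Window additivity (sorry-free) -/

/-- Pointwise additivity of the type function over adjacent windows `[lo, mid) ⊔ [mid, hi) = [lo, hi)`. [folklore] -/
theorem Φw_split (ε : ℝ) (x : ℕ) {lo mid hi : ℝ} (h₁ : lo ≤ mid) (h₂ : mid ≤ hi) (m : ℕ) :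
    Φw ε x lo hi m = Φw ε x lo mid m + Φw ε x mid hi m := by
  simp only [Φw]
  by_cases hlo : lo ≤ (m.minFac : ℝ)
  · by_cases hmid : (m.minFac : ℝ) < mid
    · have hhi : (m.minFac : ℝ) < hi := lt_of_lt_of_le hmid h₂
      have hnm : ¬ (mid ≤ (m.minFac : ℝ)) := not_le.mpr hmid
      simp [hlo, hmid, hhi, hnm]
    · have hm : mid ≤ (m.minFac : ℝ) := not_lt.mp hmid
      simp [hlo, hmid, hm]
  · have hq : (m.minFac : ℝ) < lo := not_le.mp hlo
    have hnm : ¬ (mid ≤ (m.minFac : ℝ)) := not_le.mpr (lt_of_lt_of_le hq h₁)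
    simp [hlo, hnm]

/-- **Exact additivity of the calibrated functional over adjacent windows**: `F` is linear in the type function
and the calibration coefficient `Π_Φ / B` is linear in `Φ`. [folklore] -/
theorem calF_split (ε : ℝ) (x : ℕ) {lo mid hi : ℝ} (h₁ : lo ≤ mid) (h₂ : mid ≤ hi) :
    calF ε x lo hi = calF ε x lo mid + calF ε x mid hi := by
  have hS : ∑ n ∈ Finset.Ioc x (2 * x), Φw ε x lo hi (n + 2) * (a n - b x n)
      = ∑ n ∈ Finset.Ioc x (2 * x), Φw ε x lo mid (n + 2) * (a n - b x n)
        + ∑ n ∈ Finset.Ioc x (2 * x), Φw ε x mid hi (n + 2) * (a n - b x n) := by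
    rw [← Finset.sum_add_distrib]
    refine Finset.sum_congr rfl fun n _ => ?_
    rw [Φw_split ε x h₁ h₂ (n + 2)]
    ring
  have hP : ∑ n ∈ Finset.Ioc x (2 * x), b x n * (ArithmeticFunction.liouville (n + 2) : ℝ) * Φw ε x lo hi (n + 2)
      = ∑ n ∈ Finset.Ioc x (2 * x), b x n * (ArithmeticFunction.liouville (n + 2) : ℝ) * Φw ε x lo mid (n + 2)
        + ∑ n ∈ Finset.Ioc x (2 * x),
            b x n * (ArithmeticFunction.liouville (n + 2) : ℝ) * Φw ε x mid hi (n + 2) := by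
    rw [← Finset.sum_add_distrib]
    refine Finset.sum_congr rfl fun n _ => ?_
    rw [Φw_split ε x h₁ h₂ (n + 2)]
    ring
  unfold calF
  rw [hS, hP]
  ring

/-! ## The composition (sorry-free) and the skeleton theorem -/

/-- **Composition in the `calF` spelling (sorry-free).** Low band `[x^{ε²}, x^{1/14})` and high band
`[x^{1/14}, x^{1/5})`, each `≤ (θ/2)·x/log x` eventually, give the full window `[x^{ε²}, x^{1/5})` `≤ θ·x/log x`
(with `ε₁ := min εL εH ¼` so that `ε² ≤ 1/14`, and `x₀ := max xL xH 1` so that the windows nest). [folklore] -/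
theorem band_glue
    (hL : ∃ ε₁ : ℝ, 0 < ε₁ ∧ ∀ ε : ℝ, 0 < ε → ε ≤ ε₁ → ∀ θ : ℝ, 0 < θ → ∃ x₀ : ℕ, ∀ x : ℕ, x₀ ≤ x →
        calF ε x ((x : ℝ) ^ (ε ^ 2)) ((x : ℝ) ^ ((1 : ℝ) / 14)) ≤ θ * (x : ℝ) / Real.log (x : ℝ))
    (hH : ∃ ε₁ : ℝ, 0 < ε₁ ∧ ∀ ε : ℝ, 0 < ε → ε ≤ ε₁ → ∀ θ : ℝ, 0 < θ → ∃ x₀ : ℕ, ∀ x : ℕ, x₀ ≤ x →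
        calF ε x ((x : ℝ) ^ ((1 : ℝ) / 14)) ((x : ℝ) ^ ((1 : ℝ) / 5)) ≤ θ * (x : ℝ) / Real.log (x : ℝ)) :
    ∃ ε₁ : ℝ, 0 < ε₁ ∧ ∀ ε : ℝ, 0 < ε → ε ≤ ε₁ → ∀ θ : ℝ, 0 < θ → ∃ x₀ : ℕ, ∀ x : ℕ, x₀ ≤ x →
        calF ε x ((x : ℝ) ^ (ε ^ 2)) ((x : ℝ) ^ ((1 : ℝ) / 5)) ≤ θ * (x : ℝ) / Real.log (x : ℝ) := by
  obtain ⟨εL, hεL, HL⟩ := hL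
  obtain ⟨εH, hεH, HH⟩ := hH
  refine ⟨min (min εL εH) (1 / 4), lt_min (lt_min hεL hεH) (by norm_num), ?_⟩
  intro ε hε hεle θ hθ
  have hεL' : ε ≤ εL := le_trans hεle (le_trans (min_le_left _ _) (min_le_left _ _))
  have hεH' : ε ≤ εH := le_trans hεle (le_trans (min_le_left _ _) (min_le_right _ _))
  have hε4 : ε ≤ 1 / 4 := le_trans hεle (min_le_right _ _)
  obtain ⟨xL, HxL⟩ := HL ε hε hεL' (θ / 2) (half_pos hθ)
  obtain ⟨xH, HxH⟩ := HH ε hε hεH' (θ / 2) (half_pos hθ)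
  refine ⟨max (max xL xH) 1, fun x hx => ?_⟩
  have hxL : xL ≤ x := le_trans (le_trans (le_max_left _ _) (le_max_left _ _)) hx
  have hxH : xH ≤ x := le_trans (le_trans (le_max_right _ _) (le_max_left _ _)) hx
  have hx1 : (1 : ℝ) ≤ (x : ℝ) := by exact_mod_cast le_trans (le_max_right _ _) hx
  have hsq : ε ^ 2 ≤ (1 : ℝ) / 14 := by nlinarith [mul_nonneg hε.le (sub_nonneg.mpr hε4)]
  have h₁ : (x : ℝ) ^ (ε ^ 2) ≤ (x : ℝ) ^ ((1 : ℝ) / 14) :=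
    Real.rpow_le_rpow_of_exponent_le hx1 hsq
  have h₂ : (x : ℝ) ^ ((1 : ℝ) / 14) ≤ (x : ℝ) ^ ((1 : ℝ) / 5) :=
    Real.rpow_le_rpow_of_exponent_le hx1 (by norm_num)
  have e1 := HxL x hxL
  have e2 := HxH x hxH
  rw [calF_split ε x h₁ h₂]
  have e3 : θ / 2 * (x : ℝ) / Real.log (x : ℝ) + θ / 2 * (x : ℝ) / Real.log (x : ℝ)
      = θ * (x : ℝ) / Real.log (x : ℝ) := by ring
  linarith

/-- **Composition, raw-signature hypothesis form (sorry-free).** The hypotheses are LITERALLY the statements of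
`stub_lowBand` and `stub_highBand`; the conclusion is the crux's own statement (its `let` spelling, definitionally
`CalibratedE1` — see `crux_iff`; stated unfolded so that `CalibratedE1_of` is the unique by-name theorem). [folklore] -/
theorem calibratedE1_of_bands
    (hL : ∃ ε₁ : ℝ, 0 < ε₁ ∧ ∀ ε : ℝ, 0 < ε → ε ≤ ε₁ → ∀ θ : ℝ, 0 < θ → ∃ x₀ : ℕ, ∀ x : ℕ, x₀ ≤ x → let z : ℝ := Real.exp (Real.log (Real.log (x : ℝ)) ^ 2); let V : ℝ := ∏ p ∈ (Finset.range ⌈z⌉₊).filter Nat.Prime, (1 - 1 / (p : ℝ)); let b : ℕ → ℝ := fun n => if ∀ p ∈ n.primeFactors, z ≤ (p : ℝ) then 1 / V else 0; let a : ℕ → ℝ := fun n => if n.Prime then Real.log (n : ℝ) else 0; let Φ : ℕ → ℝ := fun m => if (x : ℝ) ^ (ε ^ 2) ≤ (m.minFac : ℝ) ∧ (m.minFac : ℝ) < (x : ℝ) ^ ((1 : ℝ) / 14) then ∑ d ∈ (Nat.divisors m).filter (fun d : ℕ => (d : ℝ) ≤ (x : ℝ) ^ ((1 : ℝ) / 2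 - 2 * ε) ∧ ∀ p ∈ d.primeFactors, (x : ℝ) ^ ((1 : ℝ) / 5) ≤ (p : ℝ)), (ArithmeticFunction.moebius d : ℝ) else 0; (∑ n ∈ Finset.Ioc x (2 * x), Φ (n + 2) * (a n - b n)) - (∑ n ∈ Finset.Ioc x (2 * x), b n * (ArithmeticFunction.liouville (n + 2) : ℝ) * Φ (n + 2)) / (∑ n ∈ Finset.Ioc x (2 * x), b n) * (∑ n ∈ Finset.Ioc x (2 * x), (ArithmeticFunction.liouville (n + 2) : ℝ) * (a n - b n)) ≤ θ * (x : ℝ) / Real.log (x : ℝ))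
    (hH : ∃ ε₁ : ℝ, 0 < ε₁ ∧ ∀ ε : ℝ, 0 < ε → ε ≤ ε₁ → ∀ θ : ℝ, 0 < θ → ∃ x₀ : ℕ, ∀ x : ℕ, x₀ ≤ x → let z : ℝ := Real.exp (Real.log (Real.log (x : ℝ)) ^ 2); let V : ℝ := ∏ p ∈ (Finset.range ⌈z⌉₊).filter Nat.Prime, (1 - 1 / (p : ℝ)); let b : ℕ → ℝ := fun n => if ∀ p ∈ n.primeFactors, z ≤ (p : ℝ) then 1 / V else 0; let a : ℕ → ℝ := fun n => if n.Prime then Real.log (n : ℝ) else 0; let Φ : ℕ → ℝ := fun m => if (x : ℝ) ^ ((1 : ℝ) / 14) ≤ (m.minFac : ℝ) ∧ (m.minFac : ℝ) < (x : ℝ) ^ ((1 : ℝ) / 5) then ∑ d ∈ (Nat.divisors m).filter (fun d : ℕ => (d : ℝ) ≤ (x : ℝ) ^ ((1 : ℝ) / 2 - 2 * ε) ∧ ∀ p ∈ d.primeFactors, (x : ℝ) ^ ((1 : ℝ) / 5) ≤ (p : ℝ)), (ArithmeticFunction.moebius d : ℝ) else 0; (∑ n ∈ Finset.Ioc x (2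 * x), Φ (n + 2) * (a n - b n)) - (∑ n ∈ Finset.Ioc x (2 * x), b n * (ArithmeticFunction.liouville (n + 2) : ℝ) * Φ (n + 2)) / (∑ n ∈ Finset.Ioc x (2 * x), b n) * (∑ n ∈ Finset.Ioc x (2 * x), (ArithmeticFunction.liouville (n + 2) : ℝ) * (a n - b n)) ≤ θ * (x : ℝ) / Real.log (x : ℝ)) :
    ∃ ε₁ : ℝ, 0 < ε₁ ∧ ∀ ε : ℝ, 0 < ε → ε ≤ ε₁ → ∀ θ : ℝ, 0 < θ → ∃ x₀ : ℕ, ∀ x : ℕ, x₀ ≤ x → let z : ℝ := Real.exp (Real.log (Real.log (x : ℝ)) ^ 2); let V : ℝ := ∏ p ∈ (Finset.range ⌈z⌉₊).filter Nat.Prime, (1 - 1 / (p : ℝ)); let b : ℕ → ℝ := fun n => if ∀ p ∈ n.primeFactors, z ≤ (p : ℝ) then 1 / V else 0; let a : ℕ → ℝ := fun n => if n.Prime then Real.log (n : ℝ) else 0; let Φ : ℕ → ℝ := fun m => if (x : ℝ) ^ (ε ^ 2) ≤ (m.minFac : ℝ) ∧ (m.minFac : ℝ) < (x : ℝ) ^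 ((1 : ℝ) / 5) then ∑ d ∈ (Nat.divisors m).filter (fun d : ℕ => (d : ℝ) ≤ (x : ℝ) ^ ((1 : ℝ) / 2 - 2 * ε) ∧ ∀ p ∈ d.primeFactors, (x : ℝ) ^ ((1 : ℝ) / 5) ≤ (p : ℝ)), (ArithmeticFunction.moebius d : ℝ) else 0; (∑ n ∈ Finset.Ioc x (2 * x), Φ (n + 2) * (a n - b n)) - (∑ n ∈ Finset.Ioc x (2 * x), b n * (ArithmeticFunction.liouville (n + 2) : ℝ) * Φ (n + 2)) / (∑ n ∈ Finset.Ioc x (2 * x), b n) * (∑ n ∈ Finset.Ioc x (2 * x), (ArithmeticFunction.liouville (n + 2) : ℝ) * (a n - b n)) ≤ θ * (x : ℝ) / Real.log (x : ℝ) :=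
  crux_iff.2 (band_glue (lowBand_iff.1 hL) (highBand_iff.1 hH))

/-- **THE SKELETON THEOREM.** The crux
`Summit.Parity.GeneralizedHardyLittlewood.Theses.ParityLeakOneFifth.CalibratedE1`, concluded BY NAME: the
raw-signature composition `calibratedE1_of_bands` (sorry-free) instantiated on the two declared stubs
`stub_lowBand`, `stub_highBand` (`sorry` enters only through those two constants; the crux's `let` spelling is
definitionally the decl, `crux_iff`). [folklore] -/
theorem CalibratedE1_of : CalibratedE1 :=
  calibratedE1_of_bands stub_lowBand stub_highBand

end Summit.Parity.GeneralizedHardyLittlewood.Cruxes.CalibratedE1.Birth
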